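/-
Origin: expansion seat `planner-pub-hodgecm-mc-axioms-1-g14-0`, handover #W84 2026-08-20T15:53:55Z md5 9853d4ed78a0 (PKG 4db7392f3fc8 → 9853d4ed78a0; 291 l.; MECHANICAL (iib-R) rewrite v3.1 of the PKG file as it stands (50 token edits; rules R1x1+RX[h₂']x49)) (`HOME/mc/pub-hodgecm-mc-axioms-1-g14/revendor/kit-r55/stage55/HodgeCM/Model/ThetaSpaceSatRightTranslate.lean`, md5 9853d4ed78a0, 291 lines);
landed by the gen-22 packager (p-g22) in gate run 55 REPLACES the earlier landed copy of `HodgeCM/Model/ThetaSpaceSatRightTranslate.lean` (seat copy carried the packager Origin header of an earlier run (stripped)).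
-/
/-
Origin: CONSTRUCTION seat `planner-pub-hodgecm-mc-theta-3-g9-0` (unit pub-hodgecm-mc-theta-3-g9, gen 9 of mc-theta-3 — theta supply /
second-lift lane; (Θ-sat) RUN-37 pin-packet owner), 2026-08-19.  NEW additive leaf `HodgeCM/Model/ThetaSpaceSatRightTranslate.lean`
(RUN-37 kit `t37-mctheta3g9.txt` row #S10): the ENGINE of binder-1's export (T4) `htransl` — right translation of a saturated,
strict, holomorphic-type `K`-type situation by an element `h ∈ G_U(𝔸)` centralising the archimedean component — with the ONE
input the abstract pin cannot supply (level correctors INSIDE the saturation subgroup, `hcorr`) kept as a HYPOTHESIS (its source is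
model1's pending ruling (L3) pin field | (L3′) E binder, STATUS 2026-08-19 theta-3-g9 ADDENDUM).  Imports: this lineage's
`Model/ThetaSpaceSatTranslate` (#S7) and `Model/ThetaHolGerm` (#S9).  0 records, 0 `def … : Prop`, nothing cited, 0 proof-hole;
expected `#print axioms` ⊆ {propext, Classical.choice, Quot.sound}.
-/
import Summits.HodgeConjecture.HodgeCM.Model.ThetaSpaceSatTranslate
import Summits.HodgeConjecture.HodgeCM.Model.ThetaHolGerm

/-!
# Saturated `K`-type situations under right translation by an archimedean-central element ((T4) engine)

For a `K`-type situation `S` (tree currency `KTypeSituation P ιinf Δ κ₁ τ₁` of `Model/ThetaSpace`) SATURATED at `KΓ`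
and an element `h ∈ G_U(𝔸)` commuting with `ιinf (G₁)` (at the pin: `h = e(1, k_f⁻¹)`), the right translates
`g ↦ θ (g h)` of its adelic theta forms are the theta forms of the **right-translated situation**
`S.rightTranslateStrict …` at any level `Δ'` (same `K`-type index group, weight group `κₕ c = h κ(c) h⁻¹`, families the
pointwise translates `ω(h,1) ∘ j`, tree `Weil1964/ThetaWeightForms.rightTranslateHom_thetaForm`), PROVIDED

* `hK    : ∀ a ∈ KΓ', h⁻¹ a h ∈ KΓ` — the new saturation subgroup conjugates into the old one (at the pin:
  `KΓ = sat(K_{Γ'})`, `KΓ' = sat(K_Γ)`, `K_Γ ≤ k_f⁻¹ K_{Γ'} k_f`; `Model/Junction/LevelSaturationConj`, kit #S6);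
* `hcorr : ∀ δ ∈ Δ', ∃ x ∈ KΓ', ιinf δ · x ∈ Γ_U ∧ x centralises ιinf (G₁)` — every element of the new arithmetic level
  has a corrector INSIDE the new saturation subgroup.  TRUE for the honest adelic side (`x := ιinf(δ)⁻¹ · δ_F`, the
  components of the rational point `δ_F` away from the distinguished archimedean place — the reason the (Θ-sat)
  saturation subgroup is `awayFromCM ⊓ cmSplitLevel`), NOT
  derivable from the abstract pin data `ThetaAdelicSide` (`rat_split` only yields a corrector in the abstract `Gfin`):
  it is the hypothesis model1 rules on ((L3) pin field `rat_split_level` | (L3′) E binder).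

Results: the translate is saturated at `KΓ'` (`IsSaturated.rightTranslateStrict`), strict (`IsStrict.rightTranslateStrict`),
its theta forms contain the right translates (`map_rightTranslateHom_thetaForms_le`,
`exists_mem_thetaForms_coe_eq_rightTranslate`; generators on the nose: `coe_thetaForm_eq_rightTranslate`,
`exists_coe_thetaForm_rightTranslateStrict_eq`), and — at the pin (namespace `HodgeCM.Model`) — it is of holomorphic
type when `S` is (`IsHolType.rightTranslateStrict`, by `IsHolGerm.comp_mul_right` of #S9); all four packaged as
`exists_saturated_strict_holType_rightTranslate`.  binder-1's (T4) `htransl` at `adm₃₄ := saturated ∧ strict ∧ IsHolType`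
is that theorem plus `hK` (#S6 at `KΓ = sat(K_Γ')`, `KΓ' = sat(K_Γ)`) plus `hh`, `hcorr` (model1's ruling).
-/

set_option autoImplicit false

noncomputable section

open Literature.Geometry.ComplexHyperbolic.BallModel (U21 Ball x₀)
open Literature.NumberTheory.Automorphic Literature.NumberTheory.Weil1964
open Literature.NumberTheory.Automorphic.WeightForms (restrictHom IsLevelCorrected IsWeightMatched isWeightMatched_of_conj)
open Literature.AlgebraicGeometry.HodgeTheory
open Literature.AlgebraicGeometry.ShimuraVarieties
open Literature.NumberTheory.Automorphic.PicardCM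
open HodgeCM.PerL34.Seesaw
open HodgeCM.Model.SupplyInstance HodgeCM.Model.SupplyResidual

namespace HodgeCM
namespace Model
namespace ThetaSpace

section RightTranslate

variable {K L : Type} [Field K] [NumberField K] [Field L] [NumberField L] [Algebra K L] [FiniteDimensional K L]
variable {J : Type} [Fintype J] {GU : Type} [Group GU] [TopologicalSpace GU] [IsTopologicalGroup GU]
  [LocallyCompactSpace GU]
variable {P : WeilPairData K L J GU} [CompactSpace (GU ⧸ P.ΓU)]
variable {G₁ K₁ W : Type} [Group G₁] [Group K₁] [AddCommGroup W] [Module ℂ W] [Module.IsReflexive ℂ W]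
variable {ιinf : G₁ →* GU} {Δ Δ' : Subgroup G₁} {κ₁ : K₁ →* G₁} {τ₁ : Representation ℂ K₁ W}

omit [TopologicalSpace GU] [IsTopologicalGroup GU] [LocallyCompactSpace GU] in
/-- (Ported verbatim from the HodgeCMPerL package; no docstring in the source.) -/
theorem conj_toMonoidHom_comp_apply {Kc : Type} [Group Kc] (κ : Kc →* GU) (h : GU) (c : Kc) :
    ((MulAut.conj h).toMonoidHom.comp κ) c = h * κ c * h⁻¹ := by
  simp

/-- **The right-translated situation** at level `Δ'`: same `K`-type data, weight group `κₕ c = h κ(c) h⁻¹`,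
families the pointwise translates `ω(h,1) ∘ j`; level-correctedness from correctors in `KΓ'` (`hcorr`) read through
the saturation of `S` at `KΓ ⊇ h⁻¹ KΓ' h`. -/
def KTypeSituation.rightTranslateStrict (S : KTypeSituation P ιinf Δ κ₁ τ₁) {h : GU}
    (hh : ∀ x : G₁, Commute h (ιinf x)) {KΓ KΓ' : Subgroup GU} (hS : S.IsSaturated KΓ)
    (hK : ∀ a ∈ KΓ', h⁻¹ * a * h ∈ KΓ)
    (hcorr : ∀ δ ∈ Δ', ∃ x ∈ KΓ', ιinf δ * x ∈ P.ΓU ∧ ∀ y : G₁, Commute x (ιinf y)) :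
    KTypeSituation P ιinf Δ' κ₁ τ₁ where
  Kc := S.Kc
  κ := (MulAut.conj h).toMonoidHom.comp S.κ
  E := S.E
  σ := S.σ
  τ := S.τ
  ι := S.ι
  hι := S.hι
  η₁ := S.η₁
  hΔ := by
    intro δ hδ
    obtain ⟨x, hxK, hxΓ, hxc⟩ := hcorr δ hδ
    obtain ⟨c, hc, hτ⟩ := hS (h⁻¹ * x * h) (hK x hxK)
    have hκ : ((MulAut.conj h).toMonoidHom.comp S.κ) c = x := by
      rw [conj_toMonoidHom_comp_apply, hc]; group
    exact ⟨c, hτ, by rw [hκ]; exact hxΓ, fun y => by rw [hκ]; exact hxc y⟩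
  hη := isWeightMatched_of_conj ιinf S.hη (k := h⁻¹) (fun x => (hh x).inv_left)
    (fun c => by rw [conj_toMonoidHom_comp_apply, inv_inv])
  𝓙 := {j' | ∃ j ∈ S.𝓙, ∀ e : S.E, j'.1 e = P.kernelDatum.W.act (P.kernelDatum.s (h, 1)) (j.1 e)}

omit [CompactSpace (GU ⧸ P.ΓU)] [Module.IsReflexive ℂ W] in
/-- **Saturation transports to the conjugated subgroup**: `S` saturated at `KΓ`, `h⁻¹ KΓ' h ⊆ KΓ` ⇒ the translate
is saturated at `KΓ'` (`κₕ c = h (h⁻¹ a h) h⁻¹ = a`). -/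
theorem KTypeSituation.IsSaturated.rightTranslateStrict {S : KTypeSituation P ιinf Δ κ₁ τ₁} {h : GU}
    (hh : ∀ x : G₁, Commute h (ιinf x)) {KΓ KΓ' : Subgroup GU} (hS : S.IsSaturated KΓ)
    (hK : ∀ a ∈ KΓ', h⁻¹ * a * h ∈ KΓ)
    (hcorr : ∀ δ ∈ Δ', ∃ x ∈ KΓ', ιinf δ * x ∈ P.ΓU ∧ ∀ y : G₁, Commute x (ιinf y)) :
    (S.rightTranslateStrict hh hS hK hcorr).IsSaturated KΓ' := by
  intro a ha
  obtain ⟨c, hc, hτ⟩ := hS (h⁻¹ * a * h) (hK a ha)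
  refine ⟨c, ?_, hτ⟩
  show ((MulAut.conj h).toMonoidHom.comp S.κ) c = a
  rw [conj_toMonoidHom_comp_apply, hc]; group

omit [CompactSpace (GU ⧸ P.ΓU)] [Module.IsReflexive ℂ W] in
/-- **Strictness transports for the pointwise translated families** (`ω(h,1) ω(κ c,1) = ω(h κ(c) h⁻¹, 1) ω(h,1)`). -/
theorem KTypeSituation.IsStrict.rightTranslateStrict {S : KTypeSituation P ιinf Δ κ₁ τ₁} (hstr : S.IsStrict) {h : GU}
    (hh : ∀ x : G₁, Commute h (ιinf x)) {KΓ KΓ' : Subgroup GU} (hS : S.IsSaturated KΓ)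
    (hK : ∀ a ∈ KΓ', h⁻¹ * a * h ∈ KΓ)
    (hcorr : ∀ δ ∈ Δ', ∃ x ∈ KΓ', ιinf δ * x ∈ P.ΓU ∧ ∀ y : G₁, Commute x (ιinf y)) :
    (S.rightTranslateStrict hh hS hK hcorr).IsStrict := by
  rintro j' ⟨j, hj, hje⟩ c e
  have hje' : ∀ e' : (S.rightTranslateStrict hh hS hK hcorr).E,
      j'.1 e' = P.kernelDatum.W.act (P.kernelDatum.s (h, 1)) (j.1 e') := hje
  show j'.1 (S.σ c e) =
    P.kernelDatum.W.act (P.kernelDatum.s (((MulAut.conj h).toMonoidHom.comp S.κ) c, 1)) (j'.1 e)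
  rw [conj_toMonoidHom_comp_apply, hje' (S.σ c e), hje' e, hstr j hj c e, ← WeilPairData.kernelDatum_act_mul,
    ← WeilPairData.kernelDatum_act_mul, ← map_mul, ← map_mul, Prod.mk_mul_mk, Prod.mk_mul_mk, mul_one,
    inv_mul_cancel_right]

omit [TopologicalSpace GU] [IsTopologicalGroup GU] [LocallyCompactSpace GU] in
/-- `κₕ c · h = h · κ c` — the compatibility feeding `rightTranslateHom κ κₕ (MonoidHom.id Kc) h`. -/
theorem conj_toMonoidHom_comp_mul_eq {Kc : Type} [Group Kc] (κ : Kc →* GU) (h : GU) (c : Kc) :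
    ((MulAut.conj h).toMonoidHom.comp κ) c * h = h * κ (MonoidHom.id Kc c) := by
  rw [conj_toMonoidHom_comp_apply, MonoidHom.id_apply, inv_mul_cancel_right]

/-- **Right translation by `h` maps the situation's theta forms into those of the translated situation**
(tree `rightTranslateHom_thetaForm`, families kept on the nose). -/
theorem KTypeSituation.map_rightTranslateHom_thetaForms_le (S : KTypeSituation P ιinf Δ κ₁ τ₁) {h : GU}
    (hh : ∀ x : G₁, Commute h (ιinf x)) {KΓ KΓ' : Subgroup GU} (hS : S.IsSaturated KΓ)
    (hK : ∀ a ∈ KΓ', h⁻¹ * a * h ∈ KΓ)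
    (hcorr : ∀ δ ∈ Δ', ∃ x ∈ KΓ', ιinf δ * x ∈ P.ΓU ∧ ∀ y : G₁, Commute x (ιinf y))
    (𝓕 : Set C(relNormOneIdeles K L ⧸ relNormOneRat K L, ℂ)) :
    (S.thetaForms 𝓕).map
        (ThetaKernelDatum.rightTranslateHom S.κ ((MulAut.conj h).toMonoidHom.comp S.κ) (MonoidHom.id S.Kc) h
          (conj_toMonoidHom_comp_mul_eq S.κ h) (fun _ => rfl)) ≤
      (S.rightTranslateStrict hh hS hK hcorr).thetaForms 𝓕 := by
  rw [Submodule.map_le_iff_le_comap]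
  refine Submodule.span_le.2 ?_
  rintro F ⟨j, hj, f, hf, rfl⟩
  have ht : P.kernelDatum.IsThetaTranslate h j.1
      ((P.ω (h, 1) : P.weilDatum.ThetaTop →ₗ[ℂ] P.weilDatum.ThetaTop) ∘ₗ j.1) :=
    P.kernelDatum.isThetaTranslate_of_act fun _ => rfl
  have hj' : (⟨(P.ω (h, 1) : P.weilDatum.ThetaTop →ₗ[ℂ] P.weilDatum.ThetaTop) ∘ₗ j.1,
      ht.isThetaEquivariant_of_conj P.kernelDatum j.2 (conj_toMonoidHom_comp_mul_eq S.κ h) (fun _ => rfl)⟩ :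
        {j' : S.E →ₗ[ℂ] P.weilDatum.ThetaTop //
          P.kernelDatum.IsThetaEquivariant ((MulAut.conj h).toMonoidHom.comp S.κ) S.σ j'}) ∈
      (S.rightTranslateStrict hh hS hK hcorr).𝓙 :=
    ⟨j, hj, fun _ => rfl⟩
  rw [SetLike.mem_coe, Submodule.mem_comap,
    P.kernelDatum.rightTranslateHom_thetaForm S.κ ((MulAut.conj h).toMonoidHom.comp S.κ)
      (MonoidHom.id S.Kc) S.ι S.hι (probHaarRelNormOneQuot K L) P.kernelDatum_thetaLinear
      (conj_toMonoidHom_comp_mul_eq S.κ h) (fun _ => rfl) (fun _ => rfl) j.2 ht f]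
  exact P.kernelDatum.thetaForm_mem_thetaForms _ _ _ _ _ _ hj' hf

/-- **Every theta form of `S` has its right `h`-translate `g ↦ θ (g h)` among the theta forms of the translated
situation** — the form-level content of binder-1's (T4) `htransl`. -/
theorem KTypeSituation.exists_mem_thetaForms_coe_eq_rightTranslate (S : KTypeSituation P ιinf Δ κ₁ τ₁) {h : GU}
    (hh : ∀ x : G₁, Commute h (ιinf x)) {KΓ KΓ' : Subgroup GU} (hS : S.IsSaturated KΓ)
    (hK : ∀ a ∈ KΓ', h⁻¹ * a * h ∈ KΓ)
    (hcorr : ∀ δ ∈ Δ', ∃ x ∈ KΓ', ιinf δ * x ∈ P.ΓU ∧ ∀ y : G₁, Commute x (ιinf y))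
    (𝓕 : Set C(relNormOneIdeles K L ⧸ relNormOneRat K L, ℂ))
    {θ : weightForms P.ΓU S.κ S.τ} (hθ : θ ∈ S.thetaForms 𝓕) :
    ∃ θ' ∈ (S.rightTranslateStrict hh hS hK hcorr).thetaForms 𝓕, (θ'.1 : GU → W) = fun g => θ.1 (g * h) :=
  ⟨_, S.map_rightTranslateHom_thetaForms_le hh hS hK hcorr 𝓕 (Submodule.mem_map_of_mem hθ), rfl⟩

/-- **The generating theta forms of the translate are the right `h`-translates of those of `S`**, as functions on
`G_U(𝔸)` (tree `rightTranslateHom_thetaForm` with `IsThetaTranslate` from the pointwise identity `j' = ω(h,1) ∘ j`). -/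
theorem KTypeSituation.coe_thetaForm_eq_rightTranslate (S : KTypeSituation P ιinf Δ κ₁ τ₁) (h : GU)
    {j : {j : S.E →ₗ[ℂ] P.weilDatum.ThetaTop // P.kernelDatum.IsThetaEquivariant S.κ S.σ j}}
    {j' : {j' : S.E →ₗ[ℂ] P.weilDatum.ThetaTop //
      P.kernelDatum.IsThetaEquivariant ((MulAut.conj h).toMonoidHom.comp S.κ) S.σ j'}}
    (hje : ∀ e : S.E, j'.1 e = P.kernelDatum.W.act (P.kernelDatum.s (h, 1)) (j.1 e))
    (f : C(relNormOneIdeles K L ⧸ relNormOneRat K L, ℂ)) :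
    ((P.kernelDatum.thetaForm (probHaarRelNormOneQuot K L) P.kernelDatum_thetaLinear
        ((MulAut.conj h).toMonoidHom.comp S.κ) j'.1 j'.2 S.ι S.hι f).1 : GU → W) =
      fun g => (P.kernelDatum.thetaForm (probHaarRelNormOneQuot K L) P.kernelDatum_thetaLinear
        S.κ j.1 j.2 S.ι S.hι f).1 (g * h) := by
  have ht : P.kernelDatum.IsThetaTranslate h j.1 j'.1 := P.kernelDatum.isThetaTranslate_of_act hje
  rw [← P.kernelDatum.rightTranslateHom_thetaForm (τ' := S.τ) (σ' := S.σ) S.κ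
    ((MulAut.conj h).toMonoidHom.comp S.κ) (MonoidHom.id S.Kc) S.ι S.hι (probHaarRelNormOneQuot K L)
    P.kernelDatum_thetaLinear (conj_toMonoidHom_comp_mul_eq S.κ h) (fun _ => rfl) (fun _ => rfl) j.2 ht f]
  rfl

/-- The same identity for a generating family of the translated situation, stated over ITS fields (so that a
consumer at the pin rewrites without unfolding the situation). -/
theorem KTypeSituation.exists_coe_thetaForm_rightTranslateStrict_eq (S : KTypeSituation P ιinf Δ κ₁ τ₁) {h : GU}
    (hh : ∀ x : G₁, Commute h (ιinf x)) {KΓ KΓ' : Subgroup GU} (hS : S.IsSaturated KΓ)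
    (hK : ∀ a ∈ KΓ', h⁻¹ * a * h ∈ KΓ)
    (hcorr : ∀ δ ∈ Δ', ∃ x ∈ KΓ', ιinf δ * x ∈ P.ΓU ∧ ∀ y : G₁, Commute x (ιinf y))
    {j' : {j' : (S.rightTranslateStrict hh hS hK hcorr).E →ₗ[ℂ] P.weilDatum.ThetaTop //
      P.kernelDatum.IsThetaEquivariant (S.rightTranslateStrict hh hS hK hcorr).κ
        (S.rightTranslateStrict hh hS hK hcorr).σ j'}}
    (hj' : j' ∈ (S.rightTranslateStrict hh hS hK hcorr).𝓙) (f : C(relNormOneIdeles K L ⧸ relNormOneRat K L, ℂ)) :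
    ∃ j ∈ S.𝓙, ((P.kernelDatum.thetaForm (probHaarRelNormOneQuot K L) P.kernelDatum_thetaLinear
        (S.rightTranslateStrict hh hS hK hcorr).κ j'.1 j'.2 (S.rightTranslateStrict hh hS hK hcorr).ι
        (S.rightTranslateStrict hh hS hK hcorr).hι f).1 : GU → W) =
      fun g => (P.kernelDatum.thetaForm (probHaarRelNormOneQuot K L) P.kernelDatum_thetaLinear
        S.κ j.1 j.2 S.ι S.hι f).1 (g * h) := by
  obtain ⟨j, hj, hje⟩ := hj'
  exact ⟨j, hj, S.coe_thetaForm_eq_rightTranslate h hje f⟩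

end RightTranslate

end ThetaSpace

/-! ### At the pin: the translate of a holomorphic-type situation is of holomorphic type -/

section Pin

open ThetaSpace

variable (hHD : exists_isReal_hodgeModel) (hI : hodgePQ_independent_of_hodgeModel)
  (h₁ : BallQuotientUniformised)  (h₃ : CMAbelianVarietyRealised)

variable {L : CMField} {ι₁ : L →+* ℂ} {V : HermSpace3 L ι₁} {c : SeesawCtx L}

/-- **`IsHolType` rides along** (`IsHolGerm.comp_mul_right`): if `Sit` (level `Γ'`) is of holomorphic type and `hfin`
centralises `ιinf (U(2,1))`, the right-translated situation (read at level `Γ`) is of holomorphic type. -/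
theorem IsHolType.rightTranslateStrict (S : ThetaAdelicSide V c) (h : IsAnisotropic L V.Hm) (Γ' Γ : Level V)
    (k : Fin 4)
    (Sit : KTypeSituation ((thetaSpaceInputIn hHD hI h₁ h₃ S h).P k)
      ((thetaSpaceInputIn hHD hI h₁ h₃ S h).ιinf Γ') ((thetaSpaceInputIn hHD hI h₁ h₃ S h).Δ Γ')
      (thetaSpaceInputIn hHD hI h₁ h₃ S h).κ₁ (thetaSpaceInputIn hHD hI h₁ h₃ S h).τ₁)
    {hfin : (thetaSpaceInputIn hHD hI h₁ h₃ S h).GU}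
    (hh : ∀ x : U21, Commute hfin ((thetaSpaceInputIn hHD hI h₁ h₃ S h).ιinf Γ' x))
    {KΓ KΓ' : Subgroup (thetaSpaceInputIn hHD hI h₁ h₃ S h).GU} (hS : Sit.IsSaturated KΓ)
    (hK : ∀ a ∈ KΓ', hfin⁻¹ * a * hfin ∈ KΓ)
    (hcorr : ∀ δ ∈ (thetaSpaceInputIn hHD hI h₁ h₃ S h).Δ Γ, ∃ x ∈ KΓ',
      (thetaSpaceInputIn hHD hI h₁ h₃ S h).ιinf Γ' δ * x ∈ ((thetaSpaceInputIn hHD hI h₁ h₃ S h).P k).ΓU ∧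
        ∀ y : U21, Commute x ((thetaSpaceInputIn hHD hI h₁ h₃ S h).ιinf Γ' y))
    (𝓕 : Set C(relNormOneIdeles (thetaSpaceInputIn hHD hI h₁ h₃ S h).K (thetaSpaceInputIn hHD hI h₁ h₃ S h).L ⧸
      relNormOneRat (thetaSpaceInputIn hHD hI h₁ h₃ S h).K (thetaSpaceInputIn hHD hI h₁ h₃ S h).L, ℂ))
    (hhol : IsHolType hHD hI h₁ h₃ S h Γ' k Sit 𝓕) :
    IsHolType hHD hI h₁ h₃ S h Γ k
      (Sit.rightTranslateStrict hh hS hK hcorr :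
        KTypeSituation ((thetaSpaceInputIn hHD hI h₁ h₃ S h).P k)
          ((thetaSpaceInputIn hHD hI h₁ h₃ S h).ιinf Γ) ((thetaSpaceInputIn hHD hI h₁ h₃ S h).Δ Γ)
          (thetaSpaceInputIn hHD hI h₁ h₃ S h).κ₁ (thetaSpaceInputIn hHD hI h₁ h₃ S h).τ₁) 𝓕 := by
  refine isHolType_of_generators hHD hI h₁ h₃ S h Γ k _ 𝓕 ?_
  intro j' hj' f hf
  obtain ⟨j, hj, e⟩ := Sit.exists_coe_thetaForm_rightTranslateStrict_eq hh hS hK hcorr hj' f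
  rw [e]
  exact (hhol _ (((thetaSpaceInputIn hHD hI h₁ h₃ S h).P k).kernelDatum.thetaForm_mem_thetaForms _ _ _ _ _ _ hj hf)).comp_mul_right hh

/-- **The (T4) engine packaged at the pin.**  A saturated (at `KΓ`), strict, holomorphic-type situation `Sit` at
level `Γ'` and an element `hfin` centralising `ιinf (U(2,1))` with `hfin⁻¹ KΓ' hfin ⊆ KΓ` and correctors in `KΓ'` for
the arithmetic level of `Γ` yield a situation at level `Γ` — saturated at `KΓ'`, strict, of holomorphic type — whose
theta forms contain every right translate `g ↦ θ (g · hfin)`, `θ` a theta form of `Sit`.  binder-1's `htransl` at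
`adm₃₄` is this with `KΓ = sat(K_Γ')`, `KΓ' = sat(K_Γ)` (`hK`: kit #S6) and `hcorr` from model1's ruling (L3)|(L3′). -/
theorem exists_saturated_strict_holType_rightTranslate (S : ThetaAdelicSide V c) (h : IsAnisotropic L V.Hm)
    (Γ' Γ : Level V) (k : Fin 4)
    (Sit : KTypeSituation ((thetaSpaceInputIn hHD hI h₁ h₃ S h).P k)
      ((thetaSpaceInputIn hHD hI h₁ h₃ S h).ιinf Γ') ((thetaSpaceInputIn hHD hI h₁ h₃ S h).Δ Γ')
      (thetaSpaceInputIn hHD hI h₁ h₃ S h).κ₁ (thetaSpaceInputIn hHD hI h₁ h₃ S h).τ₁)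
    {hfin : (thetaSpaceInputIn hHD hI h₁ h₃ S h).GU}
    (hh : ∀ x : U21, Commute hfin ((thetaSpaceInputIn hHD hI h₁ h₃ S h).ιinf Γ' x))
    {KΓ KΓ' : Subgroup (thetaSpaceInputIn hHD hI h₁ h₃ S h).GU} (hS : Sit.IsSaturated KΓ) (hstr : Sit.IsStrict)
    (hK : ∀ a ∈ KΓ', hfin⁻¹ * a * hfin ∈ KΓ)
    (hcorr : ∀ δ ∈ (thetaSpaceInputIn hHD hI h₁ h₃ S h).Δ Γ, ∃ x ∈ KΓ',
      (thetaSpaceInputIn hHD hI h₁ h₃ S h).ιinf Γ' δ * x ∈ ((thetaSpaceInputIn hHD hI h₁ h₃ S h).P k).ΓU ∧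
        ∀ y : U21, Commute x ((thetaSpaceInputIn hHD hI h₁ h₃ S h).ιinf Γ' y))
    (𝓕 : Set C(relNormOneIdeles (thetaSpaceInputIn hHD hI h₁ h₃ S h).K (thetaSpaceInputIn hHD hI h₁ h₃ S h).L ⧸
      relNormOneRat (thetaSpaceInputIn hHD hI h₁ h₃ S h).K (thetaSpaceInputIn hHD hI h₁ h₃ S h).L, ℂ))
    (hhol : IsHolType hHD hI h₁ h₃ S h Γ' k Sit 𝓕) :
    ∃ Sit' : KTypeSituation ((thetaSpaceInputIn hHD hI h₁ h₃ S h).P k) ((thetaSpaceInputIn hHD hI h₁ h₃ S h).ιinf Γ)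
        ((thetaSpaceInputIn hHD hI h₁ h₃ S h).Δ Γ) (thetaSpaceInputIn hHD hI h₁ h₃ S h).κ₁ (thetaSpaceInputIn hHD hI h₁ h₃ S h).τ₁,
      Sit'.IsSaturated KΓ' ∧ Sit'.IsStrict ∧ IsHolType hHD hI h₁ h₃ S h Γ k Sit' 𝓕 ∧
        ∀ θ ∈ Sit.thetaForms 𝓕, ∃ θ' ∈ Sit'.thetaForms 𝓕, θ'.1 = fun g => θ.1 (g * hfin) :=
  ⟨_, hS.rightTranslateStrict hh hK hcorr, hstr.rightTranslateStrict hh hS hK hcorr,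
    IsHolType.rightTranslateStrict hHD hI h₁ h₃ S h Γ' Γ k Sit hh hS hK hcorr 𝓕 hhol,
    fun _ hθ => Sit.exists_mem_thetaForms_coe_eq_rightTranslate hh hS hK hcorr 𝓕 hθ⟩

end Pin

end Model
end HodgeCM

end
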